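import Summits.RiemannHypothesis.RiemannHypothesis.Theorems.Splittings.RobinFiniteTail
import Summits.RiemannHypothesis.RiemannHypothesis.Theorems.Splittings.RobinFiniteE1c
import HarnessLib

/-!
# Splittings — Robin finite lens: Nicolas's lower inequality (2.18) on `[X₀, X₁]` with NO TAIL HYPOTHESIS — the proved tail input
# (`RobinFiniteTail`) plugged into the tree's E1c⁻ headline (`RobinFiniteE1c`) (SPLIT-robin-finite gen 6, part (B); zero-def raw form)

Cell rh-split, seat rh-split-robin-finite g6 (brief sha16 f79c5f09d8bcb036), card `run/shared/lean/pub/rh-split/cards/SPLIT-robin-finite.md`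
§13; zero-definition raw form of `HOME/rh-split-robin-finite/SketchG6-Tail.lean` (sha16 00806b33b3847ae4; referee rh-split-ref g3
2026-08-27T04:13:52Z: DELIVERABLE, farm rc 0 / 0 warn / 0 sorry, std axioms on `zeroTailBound_tailH`, `zeroTailBound_PT`,
`nicolasLowerBetween_PT_tailFree`; CONTENT REPLAY PASS for a zero-def carve), filed by rh-split-typer-1 g4 (lead ORDER 04:17:26Z).
The scratch's interface defs `ZeroTailBound T h` (`Σ_{|Im ρ|>T} m(ρ)/(Im ρ)² ≤ h`, all non-trivial zeros, with multiplicity, no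
hypothesis on real parts), `lehmanH`, `lehmanTail`, `tailH` are SPELLED OUT VERBATIM at every site; proofs are the scratch's with the
`unfold` steps of the spelled-out abbreviations removed; `zeroTailBound_mono` (= `le_trans`) inlined; the scratch's `summable_tailTerm'`
(T ≥ 7) is not carried — the tree's `RobinFiniteE1c.summable_tailTerm` (every `T`, p494053) is the same statement.
HONEST LABEL: «SPLITTING SEARCH over kernel-typed RH-EQUIVALENCES; a splitting A ∧ B ⟹ RH is CONDITIONAL bookkeeping
unless A and B are both proved; nothing here bears on the truth of RH.»

This part (referee labels 04:13:52Z: `nicolasLowerBetween_PT_tailFree` = RH-FREE KERNEL THEOREM CONDITIONAL on {`Buthe2016_thm2`,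
`Buthe2018_thm2_theta`, `BroadbentEtAl2021_theta_rel_1e19`, RH(H₀) Platt–Trudgian} — four THEOREMS IN PRINT in hypothesis position, no
conjecture; class (robin, finite) UNCHANGED):
* `nicolasLowerBetween_PT_tailFree` — THE BOOK'S E1 ∧ E2 AT THE PLATT–TRUDGIAN HEIGHT WITH NO TAIL HYPOTHESIS: tree
  `RobinFiniteE1c.nicolasLowerBetween_PT` ∘ `RobinFiniteTail.zeroTailBound_PT`; Nicolas's (2.18) at every `x ∈ [X₀, X₁]`, `599 ≤ x`,
  `X₁ ≤ 2.169·10²⁵`, with the explicit budget `0.0463 + 2(1 + 2/log X₀)·2.961·10⁻¹²·√X₁` (`≤ 0.147` on `[10¹², 2.5·10²⁰]`);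
* `partialNicolasBetween_tailFree` — the same at ANY verification height `T ≥ 7` (tree `RobinFiniteE1c.partialNicolasBetween_of_tail` ∘
  `RobinFiniteTail.zeroTailBound_tailH`): the zeros above `T` are priced by the KERNEL, not by a hypothesis.
-/

set_option linter.dupNamespace false

noncomputable section

open Complex Filter Set MeasureTheory Topology intervalIntegral Finset
open scoped Real ComplexConjugate

namespace Summit.RiemannHypothesis.RiemannHypothesis.Theorems.Splittings.RobinFiniteTail

open Literature.NumberTheory.LFunctions
open Literature.NumberTheory.LFunctions.SchoenfeldBound
open Literature.NumberTheory.LFunctions.NicolasJExplicit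

open Literature.NumberTheory.DiophantineGeometry
open NicolasJ NicolasFz NicolasK
open scoped Chebyshev

/-- `tailH T ≥ 0` for `T ≥ 7` (spelled out). -/
theorem tailH_nonneg {T : ℝ} (hT : 7 ≤ T) :
    0 ≤ (Real.log (T / (2 * π)) + 1) / (π * T) + (184 + 30 * Real.log T) / T ^ 2 := by
  have hπ := Real.pi_pos
  have hπ' := Real.pi_lt_d2
  have hl : 0 ≤ Real.log (T / (2 * π)) := by
    refine Real.log_nonneg ?_
    rw [le_div_iff₀ (by positivity)]
    nlinarith
  have hlT : 0 ≤ Real.log T := Real.log_nonneg (by linarith)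
  positivity

/-- **THE BOOK'S E1 ∧ E2 AT THE PLATT–TRUDGIAN HEIGHT WITH NO TAIL HYPOTHESIS** (tree
`RobinFiniteE1c.nicolasLowerBetween_PT` ∘ `RobinFiniteTail.zeroTailBound_PT`): modulo the three RH-free named
θ-facts and `RiemannHypothesisUpTo 3000175332800` ONLY, Nicolas's lower inequality (2.18) holds at every
`x ∈ [X₀, X₁]`, `599 ≤ x`, `X₁ ≤ 2.169·10²⁵`, with the explicit budget `0.0463 + 2(1 + 2/log X₀)·2.961·10⁻¹²·√X₁`
(`≤ 0.147` on `[10¹², 2.5·10²⁰]`).  Nothing here bears on the truth of RH. -/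
theorem nicolasLowerBetween_PT_tailFree (h16 : Buthe2016_thm2) (hB : Buthe2018_thm2_theta)
    (hK : BroadbentEtAl2021_theta_rel_1e19) (hRH : RiemannHypothesisUpTo 3000175332800)
    {X₀ X₁ : ℝ} (hX₀ : 1 < X₀) (hX₁ : X₁ ≤ 2.169e25) :
    ∀ x : ℝ, 599 ≤ x → X₀ ≤ x → x ≤ X₁ →
      -Real.log (nicolasF x) ≤ RobinAnalyticSharp.nicolasERH x +
          (0.0463 + 2 * (1 + 2 / Real.log X₀) * (2.961e-12 * √X₁) - nicolasBeta) *
            (1 / (√x * Real.log x) + 1 / (√x * Real.log x ^ 2) + 4 / (√x * Real.log x ^ 3)) :=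
  Summit.RiemannHypothesis.RiemannHypothesis.Theorems.Splittings.RobinFiniteE1c.nicolasLowerBetween_PT
    h16 hB hK hRH (h := 2.961e-12) zeroTailBound_PT (by norm_num) hX₀ hX₁

/-- **the same at ANY verification height `T ≥ 7`** (tree `partialNicolasBetween_of_tail` ∘ `zeroTailBound_tailH`):
given RH up to `T` and Schoenfeld's `θ`-window on `[599, B]`, Nicolas's (2.18) holds on `[X₀, X₁] ⊆ (1, B]` with budget
`0.0463 + 2(1 + 2/log X₀)·tailH(T)·√X₁` — the zeros above `T` are priced by the KERNEL, not by a hypothesis. -/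
theorem partialNicolasBetween_tailFree (hB : Buthe2018_thm2_theta) (hK : BroadbentEtAl2021_theta_rel_1e19)
    {T B X₀ X₁ : ℝ} (hT : 7 ≤ T) (hX₀ : 1 < X₀) (hBB : X₁ ≤ B) :
    RiemannHypothesisUpTo T → (∀ y : ℝ, 599 ≤ y → y ≤ B → |θ y - y| ≤ √y * Real.log y ^ 2 / (8 * π)) →
      ∀ x : ℝ, 599 ≤ x → X₀ ≤ x → x ≤ X₁ →
        -Real.log (nicolasF x) ≤ RobinAnalyticSharp.nicolasERH x +
            (0.0463 + 2 * (1 + 2 / Real.log X₀) *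
              (((Real.log (T / (2 * π)) + 1) / (π * T) + (184 + 30 * Real.log T) / T ^ 2) * √X₁) - nicolasBeta) *
              (1 / (√x * Real.log x) + 1 / (√x * Real.log x ^ 2) + 4 / (√x * Real.log x ^ 3)) :=
  Summit.RiemannHypothesis.RiemannHypothesis.Theorems.Splittings.RobinFiniteE1c.partialNicolasBetween_of_tail
    hB hK (zeroTailBound_tailH hT) (tailH_nonneg hT) hX₀ hBB

end Summit.RiemannHypothesis.RiemannHypothesis.Theorems.Splittings.RobinFiniteTail

end
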